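import Mathlib.Analysis.SpecialFunctions.Gamma.Basic
import Mathlib.RingTheory.Algebraic.Basic
import Mathlib.Algebra.Order.Floor.Defs
import HarnessLib

/-!
# Algebraic Γ-monomials of Hodge type (Deligne 1982, Thm. 7.15 / 7.18; Koblitz–Ogus)

NAMED FACT (no proof in the tree). Source: P. Deligne, *Hodge cycles on abelian varieties*
(notes by J. S. Milne), in: Hodge Cycles, Motives, and Shimura Varieties, LNM 900 (1982), §7,
"Restatement of the theorem" and Theorem 7.18 (a); Remark 7.16 (a): the algebraicity statement
has an elementary proof, the appendix by Koblitz and Ogus to Deligne, *Valeurs de fonctions L et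
périodes d'intégrales*, PSPM 33 (1979).

Printed statement (LNM 900, §7, before Thm. 7.18). For `b ∈ d⁻¹ℤ/ℤ` write `⟨b⟩` for the
representative of `b` in `d⁻¹ℤ` with `1/d ≤ ⟨b⟩ ≤ 1`. Let `𝐛 = Σ n(b) δ_b` be an element of the free
abelian group generated by `d⁻¹ℤ/ℤ ∖ {0}`, and assume that `Σ n(b) ⟨u b⟩ = c` is an integer
independent of the unit `u ∈ (ℤ/dℤ)ˣ`. Define `Γ̃(𝐛) = (2πi)^{-c} Π_b Γ(⟨b⟩)^{n(b)}`.
**Theorem 7.18 (a)** (first clause): `Γ̃(𝐛) ∈ k^{ab}`, `k = ℚ(e^{2πi/d})`; in particular `Γ̃(𝐛)` is an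
algebraic number. (Thm. 7.15 is the case of an `(n+2)`-tuple `𝐚 ∈ X(S)` with `⟨u𝐚⟩` constant.)

## Design

* `𝐛` is encoded by multiplicities `n : ℕ → ℤ` on the numerators `i ∈ [1, d)` of `b = i/d`
  (`b = 0` is excluded in print; here it is simply not in the index range `Finset.Ico 1 d`).
* For a unit `u` and `d ∤ i`, `u·i/d ∉ ℤ`, so Deligne's `⟨u b⟩ ∈ [1/d, 1]` coincides with the
  fractional part `Int.fract (u i / d) ∈ (0,1)`; we use `Int.fract` (in `ℚ`).
* Conclusion recorded in the weak form the period routes consume: `IsAlgebraic ℚ (Γ̃(𝐛))` as a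
  complex number (`zpow` for the possibly negative exponents `-c`, `n i`). The finer statements
  (7.18 (a) Galois action by the Hecke character `χ_𝐛`, (b) the cocycle `λ_𝐛`) are not vendored.
* Beta form used by `Summits/KontsevichZagierPeriods/…/Theses/MotivatedMoves` (GammaHodgeSector):
  `B(x,y) = Γ(x)Γ(y)/Γ(x+y)`, so `Π_j B(x_j,y_j) / Π_l B(x'_l,y'_l) = Γ(𝐛)·(rational)` for
  `𝐛 = Σ_j (δ_{x_j} + δ_{y_j} − δ_{x_j+y_j}) − Σ_l (…)` (classes mod `1`, integer classes dropped,
  `Γ(t+1) = tΓ(t)`), and the route's "Hodge-type condition = k for all u coprime to the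
  denominators" is exactly the hypothesis below with `c = k`; the theorem then gives
  `Π B(x_j,y_j) = c'·π^k·Π B(x'_l,y'_l)` with `c'` real algebraic (the ratio is real and positive).

Mathlib has `Real.Gamma`, `Complex.Gamma`, `Int.fract`, `IsAlgebraic`; it has no Γ-monomial /
Chowla–Selberg / Koblitz–Ogus material (`lean search "Koblitz"`, `"Chowla"`: 0 relevant decls).
-/

noncomputable section

namespace Literature.NumberTheory.Transcendental

/-- The **Hodge-type (Koblitz–Ogus) condition** on a Γ-monomial `Π_{0<i<d} Γ(i/d)^{n i}`:
for every `u` coprime to `d`, `Σ_{0<i<d} n_i · {u i / d} = c` (fractional parts; `c ∈ ℤ` fixed,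
independent of `u`). This is Deligne's "`Σ n(b)⟨u b⟩ = c` is an integer independent of `u`"
(LNM 900, §7, restatement before Thm. 7.18). [cite: Deligne1982HodgeCycles, §7 (restatement before Thm. 7.18)] -/
def IsHodgeTypeGammaMonomial (d : ℕ) (n : ℕ → ℤ) (c : ℤ) : Prop :=
  ∀ u : ℕ, Nat.Coprime u d →
    (∑ i ∈ Finset.Ico 1 d, (n i : ℚ) * Int.fract ((u : ℚ) * i / d)) = c

/-- Deligne's normalised Γ-monomial `Γ̃(𝐛) = (2πi)^{-c} · Π_{0<i<d} Γ(i/d)^{n i}` as a complex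
number (LNM 900, §7). [cite: Deligne1982HodgeCycles, §7 (restatement before Thm. 7.18)] -/
def gammaTilde (d : ℕ) (n : ℕ → ℤ) (c : ℤ) : ℂ :=
  (2 * (Real.pi : ℂ) * Complex.I) ^ (-c) *
    ∏ i ∈ Finset.Ico 1 d, ((Real.Gamma ((i : ℝ) / d) : ℂ)) ^ (n i)

/-- NAMED FACT — **algebraicity of Γ-monomials of Hodge type** (Deligne 1982, LNM 900, Thm. 7.18 (a),
first clause; the case of tuples is Thm. 7.15 (a); elementary proof: Koblitz–Ogus, appendix to
Deligne 1979a, cf. Rem. 7.16 (a)). If `d > 1` and the Γ-monomial with multiplicities `n` on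
`{1/d, …, (d−1)/d}` satisfies the Hodge-type condition with integer `c`, then
`Γ̃(𝐛) = (2πi)^{-c} Π Γ(i/d)^{n i}` is an algebraic number (print: it even lies in the maximal
abelian extension of `ℚ(e^{2πi/d})`, with Frobenius acting through Gauss sums — not recorded here).
Users take `(h : deligne_gammaMonomial_algebraic)`. [cite: Deligne1982HodgeCycles, Thm. 7.18 (a)] -/
def deligne_gammaMonomial_algebraic : Prop :=
  ∀ (d : ℕ) (n : ℕ → ℤ) (c : ℤ), 1 < d → IsHodgeTypeGammaMonomial d n c →
    IsAlgebraic ℚ (gammaTilde d n c)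

/-! ### Sanity checks of the encoding -/

/-- Example (Euler's reflection / `Γ(1/2)² = π`): `d = 2`, `n 1 = 2`, `c = 1`: for every odd `u`,
`2·{u/2} = 1`, so the condition holds; the fact then asserts `(2πi)⁻¹ Γ(1/2)² = 1/(2i)` is
algebraic (true). [folklore] -/
example : IsHodgeTypeGammaMonomial 2 (fun i => if i = 1 then 2 else 0) 1 := by
  intro u hu
  obtain ⟨m, hm⟩ : Odd u := Nat.coprime_two_right.mp hu
  have hfr : Int.fract ((u : ℚ) / 2) = 1 / 2 := by
    subst hm
    rw [Int.fract_eq_iff]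
    refine ⟨by norm_num, by norm_num, ⟨m, ?_⟩⟩
    push_cast
    ring
  simp [hfr]

end Literature.NumberTheory.Transcendental
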